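import Literature.AlgebraicGeometry.Resolution.FiniteCoverFormalFibres
import Literature.AlgebraicGeometry.Resolution.SemiGenericFormalFibresTransport
import Literature.AlgebraicGeometry.Resolution.FrobeniusTwistPolynomial
import Literature.AlgebraicGeometry.Resolution.GRingPolynomialKernelCharZero
import Literature.AlgebraicGeometry.Resolution.FormalFibresInseparable
import Mathlib.FieldTheory.Extension
import Mathlib.FieldTheory.PurelyInseparable.Exponent
import Mathlib.FieldTheory.SplittingField.Construction
import HarnessLib

/-!
# Grothendieck's theorem on G-rings (Stacks 07PV), the kernel: the generic formal fibre of
# `A[x]_Q` in characteristic `p` (Stacks 07PR with `m = 1`)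

Topic: `Literature/AlgebraicGeometry/Resolution`. The case `𝔯 = 0` in characteristic `p` of the
kernel `hker` of `GRingPolynomialCoreReduction.lean`: for a complete regular local ring `A` of
characteristic `p`, a prime `Q` of `A[x]`, `S = A[x]_Q` and its completion `Ŝ`, the generic
formal fibre `Frac(A[x]) ⊗_S Ŝ` is geometrically regular over `K(x) = Frac(A[x])` (The Stacks
Project, Tag 07PR = Lemma 15.51.5 for `k⟦x_1, …, x_n⟧[y]`, as used in the proof of Tag 07PV).

Proof. By `isGeometricallyRegular_of_purelyInseparable` it suffices to show that
`k' ⊗_S Ŝ` is regular for a finite purely inseparable extension `k'` of `K(x)`, say of exponent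
`q = p^e`. Rather than running the induction of 07PR over `K(x)`, we embed `k'` into
`M = L(y)`, `y^q = x`, for a finite extension `L/K` (`K = Frac A`) containing `q`-th roots of the
coefficients of the numerators and denominators of a `K(x)`-basis of `k'` raised to the `q`-th
power (Frobenius: `g(x) = g(y^q) = (Σ c_j^{1/q} y^j)^q`, `FrobeniusTwistPolynomial.lean`);
regularity descends along the faithfully flat `k' ⊗_S Ŝ → M ⊗_S Ŝ` (Stacks 07NG). And
`M ⊗_S Ŝ = Π_𝔫 M ⊗_C (C_𝔫)^` for the finite `S`-algebra `C = S ⊗_{A[x]} A[y]` (Stacks 07N9,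
`FiniteCoverFormalFibres.lean`), whose local rings `C_𝔫` are local rings of the polynomial ring
`A[y]`, so that each factor is a localisation of `L ⊗_A (C_𝔫)^`, regular by Stacks 07PR for
polynomial rings over `A` (`SemiGenericFormalFibresPolynomial.lean`, transported in
`SemiGenericFormalFibresTransport.lean`). Everything is PROVED; no new notions, no named facts.

## Content (namespace `Literature.AlgebraicGeometry.Resolution`)

* `isRegularRing_tensor_completion_of_frobTwist` — `M ⊗_S Ŝ` is regular (abstract `T ≅ A[y]`,
  `C`, `𝕃 = T ⊗_A L`, `M = Frac 𝕃`).
* `isGeometricallyRegular_fibre_bot_polynomial_of_charP` — the generic formal fibre of `A[x]_Q`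
  is geometrically regular (`A` complete regular local of characteristic `p`).
* `hasGeomRegularGenericFormalFibre_polynomial_quotient_bot_of_charP` — the case `𝔯 = 0`,
  characteristic `p`, of the kernel `hker`.

## Sources

* The Stacks Project, Tags 07PR (Lemma 15.51.5), 07PV (proof), 07N9, 07NG. [StacksProject]
* H. Matsumura, *Commutative Ring Theory*, CUP 1986, proof of Thm. 32.3, pp. 258–259; proof of
  Thm. 32.5, p. 260. [Matsumura1987]
-/

noncomputable section

open IsLocalRing TensorProduct Polynomial

namespace Literature.AlgebraicGeometry.Resolution

universe u

/-! ## `M ⊗_S Ŝ` is regular for `M = Frac(A[y] ⊗_A L)` -/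

section Engine

variable (A : Type u) [CommRing A] [IsRegularLocalRing A] [IsAdicComplete (maximalIdeal A) A]
  (K : Type u) [Field K] [Algebra A K] [IsFractionRing A K]
  (L : Type u) [Field L] [Algebra K L] [FiniteDimensional K L] [Algebra A L] [IsScalarTower A K L]
  (Q : Ideal A[X]) [Q.IsPrime]
  (S : Type u) [CommRing S] [IsLocalRing S] [Algebra A[X] S] [IsLocalization.AtPrime S Q]
  -- `T ≅ A[y]`, an `A[x]`-algebra
  (T : Type u) [CommRing T] [Algebra A T] [Algebra A[X] T] (eT : T ≃ₐ[A] A[X])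
  -- `C`, the localisation of `T` at the image of `A[x] ∖ Q`, a finite `S`-algebra
  (C : Type u) [CommRing C] [Algebra T C] [Algebra A C] [IsScalarTower A T C] [Algebra S C]
  [Module.Finite S C] [IsLocalization (Algebra.algebraMapSubmonoid T Q.primeCompl) C]
  -- `𝕃 = T ⊗_A L` and `M = Frac 𝕃`
  (𝕃 : Type u) [CommRing 𝕃] [Algebra T 𝕃] [Algebra A 𝕃] [IsScalarTower A T 𝕃]
  [Algebra L 𝕃] [IsScalarTower A L 𝕃] [Algebra.IsPushout A T L 𝕃]
  (M : Type u) [Field M] [Algebra 𝕃 M] [IsFractionRing 𝕃 M] [Algebra T M] [IsScalarTower T 𝕃 M]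
  [Algebra C M] [IsScalarTower T C M] [Algebra S M] [IsScalarTower S C M]

include Q K L T eT C 𝕃 in
/-- **`M ⊗_S Ŝ` is a regular ring** for `S = A[x]_Q` (`A` complete regular local), `T ≅ A[y]` a
finite `A[x]`-algebra, `C` the localisation of `T` at the image of `A[x] ∖ Q` with its finite
`S`-algebra structure, `L` a finite extension of `Frac A`, `𝕃 = T ⊗_A L` and `M = Frac 𝕃` (all
abstract): `M ⊗_S Ŝ = Π_𝔫 M ⊗_C (C_𝔫)^` (Stacks 07N9); `C_𝔫` is a local
ring of `T ≅ A[y]` at a prime, so `L ⊗_A (C_𝔫)^` is regular (Stacks 07PR for `A[y]`), hence so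
are `𝕃 ⊗_T (C_𝔫)^ ≅ L ⊗_A (C_𝔫)^`, its localisation `M ⊗_T (C_𝔫)^`, and
`M ⊗_C (C_𝔫)^ ≅ M ⊗_T (C_𝔫)^`. [cite: StacksProject, Tag 07PR] -/
theorem isRegularRing_tensor_completion_of_frobTwist :
    IsRegularRing (M ⊗[S] AdicCompletion (maximalIdeal S) S) := by
  classical
  haveI : IsNoetherianRing S := IsLocalization.isNoetherianRing Q.primeCompl S inferInstance
  refine isRegularRing_tensor_adicCompletion_of_forall_maximal S C M fun n => ?_
  haveI := n.isMaximal
  let Cn := Localization.AtPrime n.asIdeal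
  let Xn := AdicCompletion (maximalIdeal Cn) Cn
  haveI : IsScalarTower C Cn Xn := isScalarTower_adicCompletion_localization C n.asIdeal
  -- `C_𝔫` is the local ring of `T` at `Q' = 𝔫 ∩ T`
  haveI : IsLocalization.AtPrime Cn (n.asIdeal.comap (algebraMap T C)) :=
    IsLocalization.isLocalization_isLocalization_atPrime_isLocalization
      (Algebra.algebraMapSubmonoid T Q.primeCompl) Cn n.asIdeal
  -- Stacks 07PR for `T ≅ A[y]`: `L ⊗_A X_𝔫` is regular
  haveI hreg : IsRegularRing (L ⊗[A] Xn) :=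
    isRegularRing_tensor_completion_of_algEquiv_polynomial A K L T eT
      (n.asIdeal.comap (algebraMap T C)) Cn
  -- `𝕃 ⊗_T X_𝔫 ≅ X_𝔫 ⊗_T (T ⊗_A L) ≅ X_𝔫 ⊗_A L ≅ L ⊗_A X_𝔫` is regular
  let e𝕃 : T ⊗[A] L ≃ₐ[T] 𝕃 := Algebra.IsPushout.equiv A T L 𝕃
  let f₁ := Algebra.TensorProduct.comm T 𝕃 Xn
  let f₂ := Algebra.TensorProduct.congr (AlgEquiv.refl (R := T) (A₁ := Xn)) e𝕃.symm
  let f₃ := Algebra.TensorProduct.cancelBaseChange A T T Xn L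
  let f₄ := Algebra.TensorProduct.comm A Xn L
  haveI h𝕃 : IsRegularRing (𝕃 ⊗[T] Xn) :=
    IsRegularRing.of_ringEquiv (R := L ⊗[A] Xn)
      (f₁.toRingEquiv.trans (f₂.toRingEquiv.trans (f₃.toRingEquiv.trans f₄.toRingEquiv))).symm
  -- its localisation `(𝕃 ⊗_T X_𝔫) ⊗_𝕃 M` at `𝕃 ∖ 0` is regular
  haveI : IsLocalization (Algebra.algebraMapSubmonoid (𝕃 ⊗[T] Xn) (nonZeroDivisors 𝕃))
      ((𝕃 ⊗[T] Xn) ⊗[𝕃] M) := IsLocalization.tensor M (nonZeroDivisors 𝕃)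
  haveI hloc : IsRegularRing ((𝕃 ⊗[T] Xn) ⊗[𝕃] M) :=
    isRegularRing_of_isLocalization
      (Algebra.algebraMapSubmonoid (𝕃 ⊗[T] Xn) (nonZeroDivisors 𝕃)) _
  -- `≅ M ⊗_𝕃 (𝕃 ⊗_T X_𝔫) ≅ M ⊗_T X_𝔫 ≅ M ⊗_C X_𝔫`
  let g₁ := Algebra.TensorProduct.comm 𝕃 (𝕃 ⊗[T] Xn) M
  let g₂ := Algebra.TensorProduct.cancelBaseChange T 𝕃 𝕃 M Xn
  let g₃ := (IsLocalization.algebraTensorEquiv (Algebra.algebraMapSubmonoid T Q.primeCompl) C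
    M Xn).symm
  exact IsRegularRing.of_ringEquiv (R := (𝕃 ⊗[T] Xn) ⊗[𝕃] M)
    (g₁.toRingEquiv.trans (g₂.toRingEquiv.trans g₃.toRingEquiv))

end Engine

/-! ## Fractions over `A[x]` in `Frac(A[x]_Q)` -/

/-- An element of the fraction field `κ` of a localisation `S` of `R` is a fraction `g/h` of
elements of `R` with `h ↦ ` nonzero. [folklore] -/
theorem exists_mul_algebraMap_eq_of_isFractionRing_of_isLocalization {R : Type u} [CommRing R]
    (N : Submonoid R) (S : Type u) [CommRing S] [IsDomain S] [Algebra R S] [IsLocalization N S]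
    (κ : Type u)
    [Field κ] [Algebra S κ] [IsFractionRing S κ] [Algebra R κ] [IsScalarTower R S κ] (f : κ) :
    ∃ g h : R, algebraMap R κ h ≠ 0 ∧ f * algebraMap R κ h = algebraMap R κ g := by
  obtain ⟨⟨a, s⟩, has⟩ := IsLocalization.surj (nonZeroDivisors S) f
  obtain ⟨⟨g, u⟩, hgu⟩ := IsLocalization.surj N a
  obtain ⟨⟨hh, v⟩, hhv⟩ := IsLocalization.surj N (s : S)
  simp only at has hgu hhv
  have hψs : algebraMap S κ s ≠ 0 := IsFractionRing.to_map_ne_zero_of_mem_nonZeroDivisors s.2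
  have hu : algebraMap R κ u ≠ 0 := by
    rw [IsScalarTower.algebraMap_apply R S κ]
    exact ((IsLocalization.map_units S u).map (algebraMap S κ)).ne_zero
  have hv : algebraMap R κ v ≠ 0 := by
    rw [IsScalarTower.algebraMap_apply R S κ]
    exact ((IsLocalization.map_units S v).map (algebraMap S κ)).ne_zero
  have hhhκ : algebraMap R κ hh = algebraMap S κ s * algebraMap R κ v := by
    rw [IsScalarTower.algebraMap_apply R S κ hh, ← hhv, map_mul, ← IsScalarTower.algebraMap_apply]
  have hgκ : algebraMap R κ g = algebraMap S κ a * algebraMap R κ u := by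
    rw [IsScalarTower.algebraMap_apply R S κ g, ← hgu, map_mul, ← IsScalarTower.algebraMap_apply]
  refine ⟨g * v, hh * u, ?_, ?_⟩
  · rw [map_mul, hhhκ]
    exact mul_ne_zero (mul_ne_zero hψs hv) hu
  · rw [map_mul, map_mul, hhhκ, hgκ, ← has]
    ring

/-! ## A finite extension of `Frac A` with prescribed `q`-th roots -/

/-- For finitely many `c ∈ A` there is a finite extension `L` of `Frac A` containing `p^e`-th
roots of all of them (a splitting field of `∏ (X^{p^e} - c)`). [folklore] -/
theorem exists_finiteDimensional_pow_eq (A : Type u) [CommRing A] (K : Type u) [Field K]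
    [Algebra A K] [IsFractionRing A K] (p : ℕ) [Fact p.Prime] [CharP A p] (e : ℕ) (cs : Finset A) :
    ∃ (L : Type u) (_ : Field L) (_ : Algebra K L) (_ : FiniteDimensional K L) (_ : Algebra A L)
      (_ : IsScalarTower A K L) (_ : CharP L p),
      ∀ c ∈ cs, ∃ d : L, d ^ p ^ e = algebraMap A L c := by
  classical
  have hp : p.Prime := Fact.out
  have hq0 : p ^ e ≠ 0 := pow_ne_zero _ hp.ne_zero
  let P : K[X] :=
    ∏ c ∈ cs, (X ^ p ^ e - Polynomial.C (algebraMap A K c))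
  haveI : CharP K p :=
    charP_of_injective_algebraMap (IsFractionRing.injective A K) p
  haveI : CharP P.SplittingField p :=
    charP_of_injective_algebraMap (algebraMap K P.SplittingField).injective p
  have hmonic : ∀ c : A, (X ^ p ^ e - Polynomial.C (algebraMap A K c)).Monic :=
    fun c => Polynomial.monic_X_pow_sub_C _ hq0
  have hP0 : P.map (algebraMap K P.SplittingField) ≠ 0 :=
    Polynomial.map_ne_zero (Polynomial.Monic.ne_zero
      (Polynomial.monic_prod_of_monic _ _ fun c _ => hmonic c))
  refine ⟨P.SplittingField, inferInstance, inferInstance, inferInstance, inferInstance, inferInstance,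
    inferInstance, fun c hc => ?_⟩
  have hsplit : ((X ^ p ^ e - Polynomial.C (algebraMap A K c)).map
      (algebraMap K P.SplittingField)).Splits :=
    Polynomial.Splits.of_dvd (Polynomial.SplittingField.splits P) hP0
      (Polynomial.map_dvd _ (Finset.dvd_prod_of_mem _ hc))
  have hdeg : ((X ^ p ^ e - Polynomial.C (algebraMap A K c)).map
      (algebraMap K P.SplittingField)).degree ≠ 0 := by
    rw [Polynomial.Monic.degree_map (hmonic c),
      Polynomial.degree_X_pow_sub_C (Nat.pos_of_ne_zero hq0)]
    exact_mod_cast hq0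
  obtain ⟨dd, hdd⟩ := hsplit.exists_eval_eq_zero hdeg
  refine ⟨dd, ?_⟩
  rw [Polynomial.map_sub, Polynomial.map_pow, Polynomial.map_X, Polynomial.map_C, eval_sub, eval_pow,
    eval_X, eval_C, sub_eq_zero] at hdd
  rw [hdd, ← IsScalarTower.algebraMap_apply]

/-! ## Descent of regularity along an embedding of fields -/

/-- **If `k'` embeds into `M` over `κ` and `M ⊗_κ F` is regular, then `k' ⊗_κ F` is regular**
(`k'/κ` finite, `F` Noetherian): `M ⊗_κ F = M ⊗_{k'} (k' ⊗_κ F)` is faithfully flat over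
`k' ⊗_κ F` (Stacks 07NG, `isRegularRing_of_isRegularRing_baseChange_field`). [folklore] -/
theorem isRegularRing_tensor_of_isScalarTower_field (κ k' M F : Type u) [Field κ] [Field k']
    [Field M] [CommRing F] [Algebra κ k'] [Algebra κ M] [Algebra k' M] [IsScalarTower κ k' M]
    [Algebra κ F] [Module.Finite κ k'] [IsNoetherianRing F] (h : IsRegularRing (M ⊗[κ] F)) :
    IsRegularRing (k' ⊗[κ] F) := by
  haveI : IsNoetherianRing (F ⊗[κ] k') := Algebra.FiniteType.isNoetherianRing F _
  haveI : IsNoetherianRing (k' ⊗[κ] F) :=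
    isNoetherianRing_of_ringEquiv _ (Algebra.TensorProduct.comm _ _ _).toRingEquiv
  haveI : IsRegularRing (M ⊗[k'] (k' ⊗[κ] F)) :=
    IsRegularRing.of_ringEquiv (R := M ⊗[κ] F)
      (Algebra.TensorProduct.cancelBaseChange κ k' k' M F).symm.toRingEquiv
  exact isRegularRing_of_isRegularRing_baseChange_field k' M _

/-! ## The generic formal fibre of `A[x]_Q` in characteristic `p` -/

section Fibre

variable (A : Type u) [CommRing A] [IsRegularLocalRing A] [IsAdicComplete (maximalIdeal A) A]
  (K : Type u) [Field K] [Algebra A K] [IsFractionRing A K]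
  (p : ℕ) [Fact p.Prime] [CharP A p] (Q : Ideal A[X]) [Q.IsPrime]
  (S : Type u) [CommRing S] [IsDomain S] [IsLocalRing S] [Algebra A[X] S]
  [IsLocalization.AtPrime S Q] [Algebra A S] [IsScalarTower A A[X] S]

include Q K in
omit [CharP A p] [IsDomain S] in
/-- **The field `M = Frac(A[y] ⊗_A L)`, `y^q = x`**: for `g_i, h_i ∈ A[x]` (`h_i ≠ 0`) and a finite
extension `L` of `Frac A` of characteristic `p` containing `q = p^e`-th roots of their
coefficients, there is a field `M` over `S = A[x]_Q`, with `S → M` injective, `M ⊗_S Ŝ` regular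
(`isRegularRing_tensor_completion_of_frobTwist`) and `g_i/h_i` a `q`-th power in `M`
(`FrobTwist.exists_pow_eq_algebraMap`). [cite: StacksProject, Tag 07PR] -/
theorem exists_field_tensor_completion_isRegularRing (e : ℕ) {d : ℕ} (g h : Fin d → A[X])
    (hh0 : ∀ i, h i ≠ 0) (L : Type u) [Field L] [Algebra K L]
    [FiniteDimensional K L] [Algebra A L] [IsScalarTower A K L]
    [CharP L p] (rt : A → L)
    (hrt : ∀ i, (∀ j ∈ (g i).support, rt ((g i).coeff j) ^ p ^ e = algebraMap A L ((g i).coeff j)) ∧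
      (∀ j ∈ (h i).support, rt ((h i).coeff j) ^ p ^ e = algebraMap A L ((h i).coeff j))) :
    ∃ (M : Type u) (_ : Field M) (_ : Algebra S M) (_ : Algebra A[X] M) (_ : IsScalarTower A[X] S M),
      Function.Injective (algebraMap S M) ∧
        IsRegularRing (M ⊗[S] AdicCompletion (maximalIdeal S) S) ∧
          ∀ i, ∃ r : M, r ^ p ^ e * algebraMap A[X] M (h i) = algebraMap A[X] M (g i) := by
  classical
  haveI : IsDomain A := isDomain_of_isRegularLocalRing A
  have hp : p.Prime := Fact.out
  have hq0 : p ^ e ≠ 0 := pow_ne_zero _ hp.ne_zero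
  -- `T = A[x][y]/(y^q - x) ≅ A[y]`, `𝕃 = T ⊗_A L` a domain of characteristic `p`
  obtain ⟨eT, -⟩ := FrobTwist.exists_algEquiv_polynomial A (p ^ e)
  haveI : Module.Finite A[X] (FrobTwist A (p ^ e)) := FrobTwist.moduleFinite hq0
  haveI : Module.Free A[X] (FrobTwist A (p ^ e)) := FrobTwist.moduleFree hq0
  haveI : Module.Flat A (FrobTwist A (p ^ e)) := Module.Flat.trans A A[X] (FrobTwist A (p ^ e))
  letI : Algebra L (FrobTwist A (p ^ e) ⊗[A] L) := Algebra.TensorProduct.rightAlgebra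
  have hinjAL : Function.Injective (algebraMap A L) := by
    rw [IsScalarTower.algebraMap_eq A K L]
    exact (algebraMap K L).injective.comp (IsFractionRing.injective A K)
  have hinjT : Function.Injective (algebraMap A[X] (FrobTwist A (p ^ e))) :=
    FrobTwist.algebraMap_injective A (p ^ e) hq0
  have hinjT𝕃 : Function.Injective (algebraMap (FrobTwist A (p ^ e)) (FrobTwist A (p ^ e) ⊗[A] L)) :=
    Algebra.TensorProduct.includeLeft_injective (S := FrobTwist A (p ^ e)) hinjAL
  have hinjX𝕃 : Function.Injective (algebraMap A[X] (FrobTwist A (p ^ e) ⊗[A] L)) := by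
    rw [IsScalarTower.algebraMap_eq A[X] (FrobTwist A (p ^ e)) (FrobTwist A (p ^ e) ⊗[A] L),
      RingHom.coe_comp]
    exact hinjT𝕃.comp hinjT
  haveI : IsDomain (FrobTwist A (p ^ e) ⊗[A] L) := by
    let e₁ := Algebra.TensorProduct.congr eT (AlgEquiv.refl (R := A) (A₁ := L))
    let e₂ := Algebra.TensorProduct.comm A A[X] L
    let e₃ := (polyEquivTensor A L).symm
    exact Function.Injective.isDomain (e₁.trans (e₂.trans e₃)).toRingEquiv.toRingHom
      (e₁.trans (e₂.trans e₃)).injective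
  haveI : CharP (FrobTwist A (p ^ e) ⊗[A] L) p :=
    charP_of_injective_algebraMap (algebraMap L (FrobTwist A (p ^ e) ⊗[A] L)).injective p
  haveI : ExpChar (FrobTwist A (p ^ e) ⊗[A] L) p := ExpChar.prime hp
  -- `q`-th roots of the `g_i`, `h_i` in `𝕃`
  have hzg := fun i => FrobTwist.exists_pow_eq_algebraMap A (p ^ e) L p e rfl rt (g i) (hrt i).1
  have hzh := fun i => FrobTwist.exists_pow_eq_algebraMap A (p ^ e) L p e rfl rt (h i) (hrt i).2
  choose zg hzg using hzg
  choose zh hzh using hzh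
  -- `M = Frac 𝕃`, an algebra over `C = S ⊗_{A[x]} T` and over `S`
  have hinjXM : Function.Injective
      (algebraMap A[X] (FractionRing (FrobTwist A (p ^ e) ⊗[A] L))) := by
    rw [IsScalarTower.algebraMap_eq A[X] (FrobTwist A (p ^ e) ⊗[A] L)
      (FractionRing (FrobTwist A (p ^ e) ⊗[A] L)), RingHom.coe_comp]
    exact (IsFractionRing.injective (FrobTwist A (p ^ e) ⊗[A] L)
      (FractionRing (FrobTwist A (p ^ e) ⊗[A] L))).comp hinjX𝕃
  letI : Algebra (FrobTwist A (p ^ e)) (S ⊗[A[X]] FrobTwist A (p ^ e)) :=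
    Algebra.TensorProduct.rightAlgebra
  haveI : IsLocalization (Algebra.algebraMapSubmonoid (FrobTwist A (p ^ e)) Q.primeCompl)
      (S ⊗[A[X]] FrobTwist A (p ^ e)) := IsLocalization.tensorRight S Q.primeCompl
  haveI : IsScalarTower A (FrobTwist A (p ^ e)) (S ⊗[A[X]] FrobTwist A (p ^ e)) :=
    IsScalarTower.of_algebraMap_eq fun a => by
      rw [Algebra.TensorProduct.algebraMap_apply, IsScalarTower.algebraMap_apply A A[X] S,
        Algebra.algebraMap_eq_smul_one (R := A[X]) (A := S), smul_tmul,
        IsScalarTower.algebraMap_apply A A[X] (FrobTwist A (p ^ e)),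
        Algebra.algebraMap_eq_smul_one (R := A[X]) (A := FrobTwist A (p ^ e))]
      rfl
  have hunits : ∀ y : Algebra.algebraMapSubmonoid (FrobTwist A (p ^ e)) Q.primeCompl,
      IsUnit (((algebraMap (FrobTwist A (p ^ e) ⊗[A] L) (FractionRing (FrobTwist A (p ^ e) ⊗[A] L))).comp
        (algebraMap (FrobTwist A (p ^ e)) (FrobTwist A (p ^ e) ⊗[A] L))) y) := by
    rintro ⟨_, x, hx, rfl⟩
    refine isUnit_iff_ne_zero.mpr fun h0 => hx ?_
    rw [RingHom.comp_apply, ← IsScalarTower.algebraMap_apply, ← IsScalarTower.algebraMap_apply] at h0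
    have hx0 : x = 0 := hinjXM (by rw [h0, map_zero])
    rw [hx0]
    exact Q.zero_mem
  let jC : S ⊗[A[X]] FrobTwist A (p ^ e) →+* FractionRing (FrobTwist A (p ^ e) ⊗[A] L) :=
    IsLocalization.lift hunits
  have hjC : ∀ t : FrobTwist A (p ^ e), jC (algebraMap (FrobTwist A (p ^ e)) _ t) =
      algebraMap (FrobTwist A (p ^ e)) (FractionRing (FrobTwist A (p ^ e) ⊗[A] L)) t := fun t => by
    rw [IsLocalization.lift_eq, RingHom.comp_apply, ← IsScalarTower.algebraMap_apply]
  letI : Algebra (S ⊗[A[X]] FrobTwist A (p ^ e)) (FractionRing (FrobTwist A (p ^ e) ⊗[A] L)) :=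
    jC.toAlgebra
  haveI : IsScalarTower (FrobTwist A (p ^ e)) (S ⊗[A[X]] FrobTwist A (p ^ e))
      (FractionRing (FrobTwist A (p ^ e) ⊗[A] L)) :=
    IsScalarTower.of_algebraMap_eq fun t => (hjC t).symm
  letI : Algebra S (FractionRing (FrobTwist A (p ^ e) ⊗[A] L)) :=
    (jC.comp (algebraMap S (S ⊗[A[X]] FrobTwist A (p ^ e)))).toAlgebra
  haveI : IsScalarTower S (S ⊗[A[X]] FrobTwist A (p ^ e)) (FractionRing (FrobTwist A (p ^ e) ⊗[A] L)) :=
    IsScalarTower.of_algebraMap_eq fun _ => rfl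
  haveI : IsScalarTower A[X] S (FractionRing (FrobTwist A (p ^ e) ⊗[A] L)) :=
    IsScalarTower.of_algebraMap_eq fun x => by
      change algebraMap A[X] _ x = jC (algebraMap S (S ⊗[A[X]] FrobTwist A (p ^ e)) (algebraMap A[X] S x))
      rw [← IsScalarTower.algebraMap_apply A[X] S (S ⊗[A[X]] FrobTwist A (p ^ e)),
        IsScalarTower.algebraMap_apply A[X] (FrobTwist A (p ^ e)) (S ⊗[A[X]] FrobTwist A (p ^ e)), hjC,
        ← IsScalarTower.algebraMap_apply]
  have hinjSM : Function.Injective (algebraMap S (FractionRing (FrobTwist A (p ^ e) ⊗[A] L))) := by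
    rw [injective_iff_map_eq_zero]
    intro s hs
    obtain ⟨x, u, rfl⟩ := IsLocalization.exists_mk'_eq Q.primeCompl s
    have h1 : algebraMap S (FractionRing (FrobTwist A (p ^ e) ⊗[A] L)) (IsLocalization.mk' S x u) *
        algebraMap A[X] _ (u : A[X]) = algebraMap A[X] _ x := by
      rw [IsScalarTower.algebraMap_apply A[X] S (FractionRing (FrobTwist A (p ^ e) ⊗[A] L)) (u : A[X]),
        ← map_mul, IsLocalization.mk'_spec, ← IsScalarTower.algebraMap_apply]
    rw [hs, zero_mul] at h1
    have hx0 : x = 0 := hinjXM (by rw [← h1, map_zero])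
    rw [hx0, IsLocalization.mk'_zero]
  -- the conclusion
  refine ⟨FractionRing (FrobTwist A (p ^ e) ⊗[A] L), inferInstance, inferInstance, inferInstance,
    inferInstance, hinjSM, ?_, fun i => ?_⟩
  · exact isRegularRing_tensor_completion_of_frobTwist A K L Q S (FrobTwist A (p ^ e)) eT
      (S ⊗[A[X]] FrobTwist A (p ^ e)) (FrobTwist A (p ^ e) ⊗[A] L)
      (FractionRing (FrobTwist A (p ^ e) ⊗[A] L))
  · have hhM : algebraMap A[X] (FractionRing (FrobTwist A (p ^ e) ⊗[A] L)) (h i) ≠ 0 :=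
      (map_ne_zero_iff _ hinjXM).mpr (hh0 i)
    refine ⟨algebraMap _ (FractionRing (FrobTwist A (p ^ e) ⊗[A] L)) (zg i) /
      algebraMap _ (FractionRing (FrobTwist A (p ^ e) ⊗[A] L)) (zh i), ?_⟩
    rw [div_pow, ← map_pow, ← map_pow, hzg i, hzh i,
      ← IsScalarTower.algebraMap_apply A[X] (FrobTwist A (p ^ e) ⊗[A] L),
      ← IsScalarTower.algebraMap_apply A[X] (FrobTwist A (p ^ e) ⊗[A] L),
      div_mul_cancel₀ _ hhM]

include p Q K in
/-- **The generic formal fibre of `S = A[x]_Q` is geometrically regular, `A` a complete regular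
local ring of characteristic `p`** (Stacks 07PR with `m = 1`): for a finite purely inseparable
extension `k'` of `κ = Frac S = K(x)` of exponent `q = p^e`, `k'` embeds over `κ` into
`M = Frac(A[y] ⊗_A L)`, `y^q = x`, for a finite extension `L` of `K = Frac A` containing `q`-th
roots of the coefficients of numerators and denominators of the `q`-th powers of a `κ`-basis of
`k'` (`exists_field_tensor_completion_isRegularRing`); `M ⊗_S Ŝ` is regular, and regularity
descends to `k' ⊗_S Ŝ` along the faithfully flat `k' ⊗_S Ŝ → M ⊗_S Ŝ` (Stacks 07NG).
[cite: StacksProject, Tag 07PR] -/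
theorem isGeometricallyRegular_fibre_bot_polynomial_of_charP :
    IsGeometricallyRegular (⊥ : Ideal S).ResidueField
      ((⊥ : Ideal S).Fiber (AdicCompletion (maximalIdeal S) S)) := by
  classical
  haveI : IsDomain A := isDomain_of_isRegularLocalRing A
  have hp : p.Prime := Fact.out
  haveI : IsNoetherianRing S := IsLocalization.isNoetherianRing Q.primeCompl S inferInstance
  haveI : IsNoetherianRing (AdicCompletion (maximalIdeal S) S) :=
    isNoetherianRing_adicCompletion_maximalIdeal S
  haveI : IsNoetherianRing ((⊥ : Ideal S).Fiber (AdicCompletion (maximalIdeal S) S)) :=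
    isNoetherianRing_fiber _
  -- `A[x] → S → κ = Frac S`, injective, characteristic `p`
  have hinjXS : Function.Injective (algebraMap A[X] S) :=
    IsLocalization.injective S Q.primeCompl_le_nonZeroDivisors
  haveI : CharP S p := charP_of_injective_algebraMap hinjXS p
  letI : Algebra A[X] (⊥ : Ideal S).ResidueField :=
    ((algebraMap S (⊥ : Ideal S).ResidueField).comp (algebraMap A[X] S)).toAlgebra
  haveI : IsScalarTower A[X] S (⊥ : Ideal S).ResidueField := IsScalarTower.of_algebraMap_eq fun _ => rfl
  have hinjSκ : Function.Injective (algebraMap S (⊥ : Ideal S).ResidueField) :=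
    IsFractionRing.injective S _
  haveI : CharP (⊥ : Ideal S).ResidueField p := charP_of_injective_algebraMap hinjSκ p
  haveI : ExpChar (⊥ : Ideal S).ResidueField p := ExpChar.prime hp
  -- reduce to a finite purely inseparable `k'`
  refine isGeometricallyRegular_of_purelyInseparable _ _ fun k' _ _ hfin hpi => ?_
  haveI := hfin
  haveI := hpi
  haveI : CharP k' p :=
    charP_of_injective_algebraMap (algebraMap (⊥ : Ideal S).ResidueField k').injective p
  haveI : ExpChar k' p := ExpChar.prime hp
  -- exponent `q = p^e`, a basis `b` with `b_i^q = f_i = g_i/h_i`, `g_i, h_i ∈ A[x]`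
  let e := IsPurelyInseparable.exponent (⊥ : Ideal S).ResidueField k'
  have hq0 : p ^ e ≠ 0 := pow_ne_zero _ hp.ne_zero
  let b := Module.finBasis (⊥ : Ideal S).ResidueField k'
  have hbq : ∀ i, ∃ f : (⊥ : Ideal S).ResidueField,
      algebraMap (⊥ : Ideal S).ResidueField k' f = b i ^ p ^ e := fun i =>
    IsPurelyInseparable.exponent_def' (⊥ : Ideal S).ResidueField p (b i)
  choose f hf using hbq
  have hgh := fun i => exists_mul_algebraMap_eq_of_isFractionRing_of_isLocalization Q.primeCompl S
    (⊥ : Ideal S).ResidueField (f i)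
  choose g h hh hgh using hgh
  have hh0 : ∀ i, h i ≠ 0 := fun i h0 => hh i (by rw [h0, map_zero])
  -- `L` with `q`-th roots of all the coefficients
  obtain ⟨L, _, _, _, _, _, _, hroot⟩ := exists_finiteDimensional_pow_eq A K p e
    (Finset.univ.biUnion fun i => (g i).coeffs ∪ (h i).coeffs)
  let rt : A → L := fun c => if hc : ∃ dd : L, dd ^ p ^ e = algebraMap A L c then hc.choose else 0
  have hrt : ∀ c ∈ (Finset.univ.biUnion fun i => (g i).coeffs ∪ (h i).coeffs),
      rt c ^ p ^ e = algebraMap A L c := fun c hc => by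
    simp only [rt, dif_pos (hroot c hc)]
    exact (hroot c hc).choose_spec
  have hcs : ∀ i, (∀ j ∈ (g i).support, rt ((g i).coeff j) ^ p ^ e = algebraMap A L ((g i).coeff j)) ∧
      (∀ j ∈ (h i).support, rt ((h i).coeff j) ^ p ^ e = algebraMap A L ((h i).coeff j)) := by
    intro i
    constructor
    · intro j hj
      exact hrt _ (Finset.mem_biUnion.mpr ⟨i, Finset.mem_univ i, Finset.mem_union_left _
        (Polynomial.coeff_mem_coeffs (Polynomial.mem_support_iff.mp hj))⟩)
    · intro j hj
      exact hrt _ (Finset.mem_biUnion.mpr ⟨i, Finset.mem_univ i, Finset.mem_union_right _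
        (Polynomial.coeff_mem_coeffs (Polynomial.mem_support_iff.mp hj))⟩)
  -- the field `M`
  obtain ⟨M, _, _, _, _, hinjSM, hMreg, hr⟩ :=
    exists_field_tensor_completion_isRegularRing A K p Q S e g h hh0 L rt hcs
  letI : Algebra (⊥ : Ideal S).ResidueField M := (IsFractionRing.lift hinjSM).toAlgebra
  haveI : IsScalarTower S (⊥ : Ideal S).ResidueField M :=
    IsScalarTower.of_algebraMap_eq fun s => (IsFractionRing.lift_algebraMap hinjSM s).symm
  haveI : IsScalarTower A[X] (⊥ : Ideal S).ResidueField M := IsScalarTower.of_algebraMap_eq fun x => by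
    rw [IsScalarTower.algebraMap_apply A[X] S (⊥ : Ideal S).ResidueField,
      ← IsScalarTower.algebraMap_apply S, ← IsScalarTower.algebraMap_apply]
  haveI : CharP M p :=
    charP_of_injective_algebraMap (algebraMap (⊥ : Ideal S).ResidueField M).injective p
  haveI : ExpChar M p := ExpChar.prime hp
  -- `k'` embeds into `M` over `κ`: `b_i ↦ (g_i/h_i)^{1/q}`
  have hK : ∀ s ∈ Set.range b, IsIntegral (⊥ : Ideal S).ResidueField s ∧
      ((minpoly (⊥ : Ideal S).ResidueField s).map (algebraMap (⊥ : Ideal S).ResidueField M)).Splits := by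
    rintro _ ⟨i, rfl⟩
    refine ⟨IsIntegral.of_finite _ (b i), ?_⟩
    obtain ⟨r, hr⟩ := hr i
    have hinjXM : Function.Injective (algebraMap A[X] M) := by
      rw [IsScalarTower.algebraMap_eq A[X] S M, RingHom.coe_comp]
      exact hinjSM.comp hinjXS
    have hhM : algebraMap A[X] M (h i) ≠ 0 := (map_ne_zero_iff _ hinjXM).mpr (hh0 i)
    have hrq : r ^ p ^ e = algebraMap (⊥ : Ideal S).ResidueField M (f i) := by
      have h2 : algebraMap (⊥ : Ideal S).ResidueField M (f i) * algebraMap A[X] M (h i) =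
          algebraMap A[X] M (g i) := by
        rw [IsScalarTower.algebraMap_apply A[X] (⊥ : Ideal S).ResidueField M (h i), ← map_mul, hgh i,
          ← IsScalarTower.algebraMap_apply]
      exact mul_right_cancel₀ hhM (hr.trans h2.symm)
    have hdvd : minpoly (⊥ : Ideal S).ResidueField (b i) ∣ X ^ p ^ e - Polynomial.C (f i) :=
      minpoly.dvd _ _ (by rw [map_sub, map_pow, aeval_X, aeval_C, hf i, sub_self])
    have hsplit : ((X ^ p ^ e - Polynomial.C (f i)).map
        (algebraMap (⊥ : Ideal S).ResidueField M)).Splits := by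
      rw [Polynomial.map_sub, Polynomial.map_pow, Polynomial.map_X, Polynomial.map_C, ← hrq,
        Polynomial.C_pow, ← sub_pow_expChar_pow]
      exact (Polynomial.Splits.X_sub_C r).pow _
    exact hsplit.of_dvd (Polynomial.map_ne_zero (Polynomial.monic_X_pow_sub_C _ hq0).ne_zero)
      (Polynomial.map_dvd _ hdvd)
  have hS : IntermediateField.adjoin (⊥ : Ideal S).ResidueField (Set.range b) = ⊤ := by
    rw [eq_top_iff]
    intro x _
    rw [← b.sum_repr x]
    refine sum_mem fun i _ => ?_
    exact IntermediateField.smul_mem _ (IntermediateField.subset_adjoin _ _ (Set.mem_range_self i))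
  obtain ⟨ψ⟩ := IntermediateField.nonempty_algHom_of_adjoin_splits hK hS
  -- descent along `k' → M` (Stacks 07NG)
  letI : Algebra k' M := ψ.toRingHom.toAlgebra
  haveI : IsScalarTower (⊥ : Ideal S).ResidueField k' M :=
    IsScalarTower.of_algebraMap_eq fun x => (ψ.commutes x).symm
  refine isRegularRing_tensor_of_isScalarTower_field (⊥ : Ideal S).ResidueField k' M _ ?_
  exact IsRegularRing.of_ringEquiv (R := M ⊗[S] AdicCompletion (maximalIdeal S) S)
    (Algebra.TensorProduct.cancelBaseChange S (⊥ : Ideal S).ResidueField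
      (⊥ : Ideal S).ResidueField M (AdicCompletion (maximalIdeal S) S)).symm.toRingEquiv

end Fibre

/-! ## The kernel `hker` for `𝔯 = 0` in characteristic `p` -/

/-- **The case `𝔯 = 0`, characteristic `p`, of the kernel `hker` of
`GRingPolynomialCoreReduction.lean`**: for a complete regular local ring `A` of characteristic
`p` and a prime `𝔫` of `A[x]/(0)`, the generic formal fibre of `(A[x]/(0))_𝔫` is geometrically
regular (`isGeometricallyRegular_fibre_bot_polynomial_of_charP` and the translation 07PN).
[cite: StacksProject, Tag 07PV (proof)] -/
theorem hasGeomRegularGenericFormalFibre_polynomial_quotient_bot_of_charP (A : Type u) [CommRing A]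
    [IsRegularLocalRing A] [IsAdicComplete (maximalIdeal A) A] (p : ℕ) [Fact p.Prime] [CharP A p]
    (n : Ideal (A[X] ⧸ (⊥ : Ideal A[X]))) [n.IsPrime] :
    HasGeomRegularGenericFormalFibre (A[X] ⧸ (⊥ : Ideal A[X])) n := by
  haveI : IsDomain A := isDomain_of_isRegularLocalRing A
  set Q : Ideal A[X] := n.comap (Ideal.Quotient.mk ⊥) with hQ
  haveI : Q.IsPrime := Ideal.comap_isPrime _ n
  haveI : IsDomain (Localization.AtPrime Q) :=
    IsLocalization.isDomain_of_le_nonZeroDivisors _ Q.primeCompl_le_nonZeroDivisors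
  have hpr : (⊥ : Ideal (Localization.AtPrime Q)).comap (algebraMap A[X] (Localization.AtPrime Q)) =
      ⊥ :=
    Ideal.comap_bot_of_injective _ (IsLocalization.injective _ Q.primeCompl_le_nonZeroDivisors)
  refine hasGeomRegularGenericFormalFibre_quotient_of_fibre Q ⊥ ⊥ hpr ?_ n hQ
  exact isGeometricallyRegular_fibre_bot_polynomial_of_charP A (FractionRing A) p Q
    (Localization.AtPrime Q)


end Literature.AlgebraicGeometry.Resolution

end
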